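import Literature.MathematicalPhysics.QuantumFieldTheory.Balaban1983to89.B9Ineq363L2
import Literature.MathematicalPhysics.QuantumFieldTheory.Balaban1983to89.B9Ineq377POne

/-!
# `Balaban1983to89.B9Ineq377L2` — [Balaban1985BackgroundPropagators] (3.49) p. 399, (3.68) p. 403 AND (3.77) p. 406 IN THE BLOCK-`ℓ²` CURRENCY OF (3.46): THE
# LETTERS OF THE NON-LOCAL OPERATOR `P₁(A)` OF (3.76) — the four (3.49)-entries of `P(U) = G′Q′*(Q′G′²Q′*)⁻¹Q′G′`, the (3.68)-entries of `P′(A)`, and the bound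
# (3.77) of `P₁(A)` — as the `ℓ²` twins of r06's `B9Ineq366CPrime` §2 (composition complement), `B9Ineq368PPrime` §§1–4 and `B9Ineq377POne` §§2–3, VERBATIM in
# this seat's `ℓ²` composition calculus; sixth brick of the kernel-free `ℓ²` route to the (3.46) members of `G(U′U)` displayed in `B9SectBStepFrameV4.SectBFrame₄`

T. Bałaban, *Propagators for lattice gauge theories in a background field*, Commun. Math. Phys. **99** (1985) 389–434
[`Balaban1985BackgroundPropagators`, "B9"]; [4] = T. Bałaban, *Propagators and renormalization transformations for lattice gauge theories. II*,
Commun. Math. Phys. **96** (1984) 223–250 [`Balaban1984PropagatorsII`].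

statement-level skeleton of published theorems with citation tags; proofs where landed; nothing here is a claim about the Yang–Mills mass gap

THE PRINTED LOCUS (verbatim).  p. 399: *"For the operator P = I − R we obtain, using again Lemma 2.1, |P(x,x′)|, |(DP)_μ(x,x′)|, |(PD*)_ν(x,x′)|, |(DPD*)_{μν}(x,x′)|
≤ O(1)[1, (Lʲη)⁻¹, (Lʲη)⁻¹, (Lʲη)⁻²](L^{j′}η)^{−d}e^{−(1/2)δ₀d(y,y′)} (3.49)"*; p. 403: *"P(U′U) = P(U) + P′(A) … (3.68) … the operator P(U′U) satisfies the
bounds (3.49)"*; p. 405–406: *"(3.76) … where the operator P₁(A) is a non-local operator whose kernel satisfies the bound |P_{1,μν}(A; x, x′)| ≤ O(1)α₁(Lʲη)⁻²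
(L^{j′}η)^{−d}e^{−(1/2)δ₀d(y,y′)} (3.77)"*; p. 407: *"Using the bounds (3.73), (3.77), (3.83) and assuming that Theorem 3.3 holds for G(U), we get (3.85) …
Theorem (3.3) implies also convergence in all norms appearing in its formulation"* — for the `L²` members of (3.46) the `P₁(A)` third of (3.85) must be read
in the block-`ℓ²` form, i.e. (3.49)/(3.68)/(3.77) in block-`ℓ²`.

WHY THIS FILE (pub-ymgap N06 row 13, seat dag-n06-c g5).  After the `V₃(A)` and `P₂(A)` thirds of (3.85)₂ (`B9Ineq385L2V3`, `…V3Right`, `B9Ineq383L2`), the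
`P₁(A)` third remains.  r06's sup route is `B9Ineq377POne.ineq377_op` (seven words in `E = D_{U′U} − D_U`, `E*`, `P`, `P′`) on the (3.49)-shaped entries of
`P(U)` (`B9Ineq368PPrime.ineq349_op`) and the (3.68)-shaped entries of `P′(A)` (`ineq368_op`, `ineq368_op_D`), all on ONE carrier `W` where the bonds, the
derivative letters, the averaging letters `Q′, Q′*` (block-local, diagonal majorants) and the inverse `(Q′G′²Q′*)⁻¹` (a letter with the (3.48)-majorant
`B₁(Lʲη)⁻⁴e^{−δd}`) live.  THIS FILE is the `ℓ²` twin of that whole chain — the SAME words and the SAME algebra with `HasMajorant` ↦ `HasL2Majorant` and the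
composition lemmas replaced by this seat's `ℓ²` ones (`B9Ineq363L2.hasL2Majorant_comp_decay`: no volume factor in `ℓ²`; `B6RandomWalkL2.hasL2Majorant_mul`);
r06's constants `kappa349`, `kappa368`, `kappa377`, the scale-transfer lemmas (`transfers_word`, `scaleTransfer_one`, …) and the ring identities
(`pOne_expand`, `B9Eq360Vprime.pPrime_explicit`, `inv_sub_inv_of_…`) are used BY NAME.  INPUTS are block-`ℓ²` majorants of the same printed shapes: (3.46)₀,₁,₂
for `G′(U)` and for `G′(U′U)` (this seat's `ℓ²` extension entries), (3.48) for `C⁻¹(U)`, `C⁻¹(U′U)` READ IN BLOCK-`ℓ²` ON THE CARRIER (instance readings / the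
(3.66) step), the block-local letters `Q′, Q′*, F′₂, F′₂*` with diagonal block-`ℓ²` majorants, the first-order letters `E, E*` with `c_Eα₁(Lʲη)⁻¹e^{−δd}`.

WHAT IS PROVED (theorems only; 0 sorry; standard axioms; no definition).
* §0 the `ℓ²` composition complement (twins of `B9Ineq366CPrime` §2 ∕ `B9Ineq368PPrime` §1): `hasL2Majorant_comp_decay_left1`, `hasL2Majorant_comp_decay_right1`,
  `hasL2Majorant_local_mul`, `hasL2Majorant_mul_local`, `hasL2Majorant_neg`, `hasL2Majorant_sub`, `hasL2Majorant_local_add`.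
* §1 `hasL2Majorant_word5`, `hasL2Majorant_word349`, ★ `ineq349_l2` — the four (3.49) entries of `B9Eq360Vprime.pOp G Qs Cinv Q` in block-`ℓ²`
  (`κ₃₄₉·[1, (Lʲη)⁻¹, (Lʲη)⁻¹, (Lʲη)⁻²]·e^{−ρd}`).
* §2 `hasL2Majorant_pPrime_words`, ★ `ineq368_l2`, ★ `ineq368_l2_D` — the (3.68) entries of `P′(A) = B9Eq360Vprime.pPrime …` in block-`ℓ²` (`κ₃₆₈·α₁·[1, (Lʲη)⁻¹]·e^{−ρd}`).
* §3 ★★ `ineq377_l2` — (3.77) in block-`ℓ²`: `P₁(A) ≺₂ κ₃₇₇·α₁·(Lʲη)⁻²·e^{−ρd}` from the (3.49)/(3.68)-shaped `ℓ²` entries and the `E`-letters; ★ `ineq377_l2_of_349` (the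
  same with the (3.49) entries discharged by §1).

HONEST SCOPE.  Finite-dimensional bookkeeping; every letter is a binder with its size as hypothesis; nothing of [B9] is asserted for Bałaban's operators; the
passage from the site kernel (3.48) to the block-`ℓ²` reading on the carrier is NOT here (instance side / successor); count-neutral; NOT a node discharge;
nothing continuum ∕ OS ∕ mass-gap ∕ Clay.  Cell `pub-ymgap` (HUMAN RULING D-0062), Track A node N06 [B9], N06-ASSIGNMENT row 13, seat `pub-ymgap-dag-n06-c` (g5),
2026-08-27.  With this file the three thirds of (3.85)₂ have `ℓ²` bricks; NOT HERE: the composites `P₁·G`, `G·P₁`, `∇G·P₁` (one `hasL2Majorant_comp_decay`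
each, as in `B9Ineq383L2` §3), the assembly `V = V₃ + P₁ + P₂` at the letters and the `L2GFrame₂` steps.
-/

noncomputable section

open scoped BigOperators

namespace Literature.MathematicalPhysics.QuantumFieldTheory.Balaban1983to89.B9Ineq377L2

open Literature.MathematicalPhysics.QuantumFieldTheory.Balaban1983to89
open Literature.MathematicalPhysics.QuantumFieldTheory.Balaban1983to89.B6RandomWalk (Triangle254 Ineq261)
open Literature.MathematicalPhysics.QuantumFieldTheory.Balaban1983to89.B6RandomWalkL2 (HasL2Majorant hasL2Majorant_mono hasL2Majorant_add
  hasL2Majorant_mul)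
open Literature.MathematicalPhysics.QuantumFieldTheory.Balaban1983to89.B9Thm34Ext (toB6)
open Literature.MathematicalPhysics.QuantumFieldTheory.Balaban1983to89.B9Ineq347 (ScaleTransfer)
open Literature.MathematicalPhysics.QuantumFieldTheory.Balaban1983to89.B9Ineq366CPrime (scaleTransfer_one)
open Literature.MathematicalPhysics.QuantumFieldTheory.Balaban1983to89.B9Ineq368PPrime (scaleTransfer_mul scaleTransfer_exp_mono scaleTransfer_const_mono
  transfers_word kappa349 kappa368)
open Literature.MathematicalPhysics.QuantumFieldTheory.Balaban1983to89.B9Ineq377POne (pOne_expand kappa377 kappa377_nonneg)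
open Literature.MathematicalPhysics.QuantumFieldTheory.Balaban1983to89.B9Eq386Neumann (pOne)
open Literature.MathematicalPhysics.QuantumFieldTheory.Balaban1983to89.B9Ineq363L2 (hasL2Majorant_comp_decay hasL2Majorant_rate_mono)

/-! ## §0  The ℓ² composition complement (twins of `B9Ineq366CPrime` §2 and `B9Ineq368PPrime` §1) -/

section Complement

variable {g : B9.Geometry} [Fintype g.Site] [DecidableEq g.Site] {R : ℝ} {H : Prop} {W : Type} [Fintype W]

omit [DecidableEq g.Site] in
/-- Composition with an UNWEIGHTED left factor (a small factor `θ·e^{−r d}`, e.g. (3.63) for `V′G′`): `T₁T₂` has majorant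
`θA₂Cc₁(β)·w₂(y)·e^{−ρ d}`. [cite: Balaban1984PropagatorsII, (2.52)–(2.55) p.232; Balaban1985BackgroundPropagators, (3.63) p.402 + (3.66) p.403] -/
theorem hasL2Majorant_comp_decay_left1 (blk : W → g.Site) (d : ℕ) (δ₀ α β ρ r C θ A₂ : ℝ) (w₂ : g.Site → ℝ)
    (hw₂ : ∀ a, 0 ≤ w₂ a) (hC : 0 ≤ C) (hθ : 0 ≤ θ) (hA₂ : 0 ≤ A₂) (hρ : 0 ≤ ρ)
    (hr : ρ + (α + β) * δ₀ ≤ r) (hdnn : ∀ a b : g.Site, 0 ≤ g.dist a b)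
    (htri : Triangle254 (toB6 g R H)) (hST : ScaleTransfer g δ₀ α C w₂)
    (h261 : Ineq261 d (toB6 g R H) δ₀ β) {T₁ T₂ : Module.End ℝ (W → ℝ)}
    (h₁ : HasL2Majorant (g := toB6 g R H) blk T₁ (fun a b => θ * Real.exp (-(r * g.dist a b))))
    (h₂ : HasL2Majorant (g := toB6 g R H) blk T₂ (fun a b => A₂ * w₂ a * Real.exp (-(ρ * g.dist a b)))) :
    HasL2Majorant (g := toB6 g R H) blk (T₁ * T₂)
      (fun a b => (θ * A₂ * C * B6.c1 d δ₀ β) * w₂ a * Real.exp (-(ρ * g.dist a b))) := by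
  have h₁' : HasL2Majorant (g := toB6 g R H) blk T₁
      (fun a b => θ * (fun _ : g.Site => (1 : ℝ)) a * Real.exp (-(r * g.dist a b))) :=
    hasL2Majorant_mono (g := toB6 g R H) blk h₁ fun a b => by simp
  have h := hasL2Majorant_comp_decay (R := R) (H := H) blk d δ₀ α β ρ r C θ A₂ (fun _ => (1 : ℝ)) w₂
    (fun _ => zero_le_one) hw₂ hC hθ hA₂ hρ hr hdnn htri hST h261 h₁' h₂
  exact hasL2Majorant_mono (g := toB6 g R H) blk h fun a b => by simp

omit [DecidableEq g.Site] in
/-- Composition with an UNWEIGHTED right factor (`T₂` a small factor `θ·e^{−ρ d}`; no scale transfer needed):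
`T₁T₂` has majorant `A₁θc₁(β)·w₁(y)·e^{−ρ d}`. [cite: Balaban1984PropagatorsII, (2.52)–(2.55) p.232; Balaban1985BackgroundPropagators, (3.63) p.402 + (3.66) p.403] -/
theorem hasL2Majorant_comp_decay_right1 (blk : W → g.Site) (d : ℕ) (δ₀ α β ρ r A₁ θ : ℝ) (w₁ : g.Site → ℝ)
    (hw₁ : ∀ a, 0 ≤ w₁ a) (hA₁ : 0 ≤ A₁) (hθ : 0 ≤ θ) (hρ : 0 ≤ ρ) (hαδ : 0 ≤ α * δ₀)
    (hr : ρ + (α + β) * δ₀ ≤ r) (hdnn : ∀ a b : g.Site, 0 ≤ g.dist a b)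
    (htri : Triangle254 (toB6 g R H)) (h261 : Ineq261 d (toB6 g R H) δ₀ β) {T₁ T₂ : Module.End ℝ (W → ℝ)}
    (h₁ : HasL2Majorant (g := toB6 g R H) blk T₁ (fun a b => A₁ * w₁ a * Real.exp (-(r * g.dist a b))))
    (h₂ : HasL2Majorant (g := toB6 g R H) blk T₂ (fun a b => θ * Real.exp (-(ρ * g.dist a b)))) :
    HasL2Majorant (g := toB6 g R H) blk (T₁ * T₂)
      (fun a b => (A₁ * θ * B6.c1 d δ₀ β) * w₁ a * Real.exp (-(ρ * g.dist a b))) := by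
  have h₂' : HasL2Majorant (g := toB6 g R H) blk T₂
      (fun a b => θ * (fun _ : g.Site => (1 : ℝ)) a * Real.exp (-(ρ * g.dist a b))) :=
    hasL2Majorant_mono (g := toB6 g R H) blk h₂ fun a b => by simp
  have h := hasL2Majorant_comp_decay (R := R) (H := H) blk d δ₀ α β ρ r 1 A₁ θ w₁ (fun _ => (1 : ℝ))
    hw₁ (fun _ => zero_le_one) zero_le_one hA₁ hθ hρ hr hdnn htri (scaleTransfer_one hαδ hdnn) h261 h₁ h₂'
  exact hasL2Majorant_mono (g := toB6 g R H) blk h fun a b => by simp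

/-- A BLOCK-LOCAL letter on the left (`Q′(U)` of (3.19), `F′₂(A)` of (3.59): the output on the block `Δ(y)` depends on the
input on `Δ(y)` only, with norm `≦ κ`, `κ ≧ 0`): if `T₁` has the block-diagonal `ℓ²` majorant `κ·𝟙[y = y′]` and `T₂` the majorant
`K`, then `T₁T₂` has majorant `κ·K` (in `ℓ²` the sign condition sits on the LEFT factor). [cite: Balaban1985BackgroundPropagators, (3.19) p.393 + (3.59) p.402; Balaban1984PropagatorsII, (2.52) p.232] -/
theorem hasL2Majorant_local_mul (blk : W → g.Site) (κ : ℝ) {T₁ T₂ : Module.End ℝ (W → ℝ)}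
    {K : g.Site → g.Site → ℝ} (hκ : 0 ≤ κ)
    (h₁ : HasL2Majorant (g := toB6 g R H) blk T₁ (fun a b : g.Site => if a = b then κ else 0))
    (h₂ : HasL2Majorant (g := toB6 g R H) blk T₂ K) :
    HasL2Majorant (g := toB6 g R H) blk (T₁ * T₂) (fun a b => κ * K a b) := by
  have hK₁ : ∀ a b : g.Site, 0 ≤ (if a = b then κ else 0) := fun a b => by
    split_ifs
    · exact hκ
    · exact le_rfl
  refine hasL2Majorant_mono (g := toB6 g R H) blk (hasL2Majorant_mul (g := toB6 g R H) blk h₁ h₂ hK₁) fun a b =>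
    le_of_eq ?_
  simp [ite_mul]

/-- A BLOCK-LOCAL letter on the right (`Q′*(U)`, `F′₂*(A)`, block-diagonal majorant `κ·𝟙[y = y′]`, `κ ≧ 0`): `T₁T₂` has
majorant `K·κ`. [cite: Balaban1985BackgroundPropagators, (3.19) p.393 + p.402 («a similar expansion for the adjoint operator»); Balaban1984PropagatorsII, (2.52) p.232] -/
theorem hasL2Majorant_mul_local (blk : W → g.Site) (κ : ℝ)
    {T₁ T₂ : Module.End ℝ (W → ℝ)} {K : g.Site → g.Site → ℝ} (hK : ∀ a b, 0 ≤ K a b)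
    (h₁ : HasL2Majorant (g := toB6 g R H) blk T₁ K)
    (h₂ : HasL2Majorant (g := toB6 g R H) blk T₂ (fun a b : g.Site => if a = b then κ else 0)) :
    HasL2Majorant (g := toB6 g R H) blk (T₁ * T₂) (fun a b => K a b * κ) := by
  refine hasL2Majorant_mono (g := toB6 g R H) blk (hasL2Majorant_mul (g := toB6 g R H) blk h₁ h₂ hK) fun a b =>
    le_of_eq ?_
  simp [mul_ite]



omit [DecidableEq g.Site] in
/-- `−T` has the majorants of `T`. [cite: Balaban1984PropagatorsII, (2.51) p.232] -/
theorem hasL2Majorant_neg (blk : W → g.Site) {T : Module.End ℝ (W → ℝ)} {K : g.Site → g.Site → ℝ}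
    (h : HasL2Majorant (g := toB6 g R H) blk T K) : HasL2Majorant (g := toB6 g R H) blk (-T) K := by
  intro y y' u hu
  have e : B6RandomWalk.blockPiece blk y ((-T) u) = -(B6RandomWalk.blockPiece blk y (T u)) := by
    funext x
    simp only [B6RandomWalk.blockPiece, LinearMap.neg_apply, Pi.neg_apply]
    split_ifs <;> simp
  rw [e, show -(B6RandomWalk.blockPiece blk y (T u)) = (-1 : ℝ) • B6RandomWalk.blockPiece blk y (T u) by simp,
    B6RandomWalkL2.l2n_smul]
  simpa using h y y' u hu

omit [DecidableEq g.Site] in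
/-- A difference has the sum of the majorants (*"A summation preserves it also"*, [4] p. 232).
[cite: Balaban1984PropagatorsII, (2.51)–(2.52) p.232] -/
theorem hasL2Majorant_sub (blk : W → g.Site) {T₁ T₂ : Module.End ℝ (W → ℝ)} {K₁ K₂ : g.Site → g.Site → ℝ}
    (h₁ : HasL2Majorant (g := toB6 g R H) blk T₁ K₁) (h₂ : HasL2Majorant (g := toB6 g R H) blk T₂ K₂) :
    HasL2Majorant (g := toB6 g R H) blk (T₁ - T₂) (fun a b => K₁ a b + K₂ a b) := by
  rw [sub_eq_add_neg]
  exact hasL2Majorant_add (g := toB6 g R H) blk h₁ (hasL2Majorant_neg (R := R) (H := H) blk h₂)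

/-- Two block-local letters add to a block-local letter ((3.57): `Q′(U′U) = Q′(U) + F′₂(A)` is block-local with norm
`κ_Q + c_Fα₁`). [cite: Balaban1985BackgroundPropagators, (3.57)–(3.59) pp.401–402] -/
theorem hasL2Majorant_local_add (blk : W → g.Site) (κ₁ κ₂ : ℝ) {T₁ T₂ : Module.End ℝ (W → ℝ)}
    (h₁ : HasL2Majorant (g := toB6 g R H) blk T₁ (fun a b : g.Site => if a = b then κ₁ else 0))
    (h₂ : HasL2Majorant (g := toB6 g R H) blk T₂ (fun a b : g.Site => if a = b then κ₂ else 0)) :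
    HasL2Majorant (g := toB6 g R H) blk (T₁ + T₂) (fun a b : g.Site => if a = b then κ₁ + κ₂ else 0) := by
  refine hasL2Majorant_mono (g := toB6 g R H) blk (hasL2Majorant_add (g := toB6 g R H) blk h₁ h₂) fun a b => le_of_eq ?_
  split_ifs <;> simp


end Complement

/-! ## §1  (3.49) in block-ℓ²: the words `A·Q₁·C·Q₂·B` and `X·Q′*·(Q′G′²Q′*)⁻¹·Q′·Y`, and the four entries of `P(U)` -/

section Ineq349

variable {g : B9.Geometry} [Fintype g.Site] [DecidableEq g.Site] {R : ℝ} {H : Prop} {W : Type} [Fintype W]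

/-- **The word `A·Q₁·C·Q₂·B`** (*"using again Lemma 2.1"*, p. 399): `A`, `C` with majorants `A_A w_A e^{−r d}`,
`A_C w_C e^{−r d}` at a rate `r ≧ ρ + (α+β)δ₀`, `B` with `A_B w_B e^{−ρ d}`, `Q₁`, `Q₂` block-local with norms `κ₁`, `κ₂`,
the scale transfer at exponent `α` with constant `Λ` for the weights `w_B` and `w_C·w_B` ((2.60)), (2.61) at `β` and
(2.54): `A·Q₁·C·Q₂·B` has the majorant `A_Aκ₁A_Cκ₂A_B Λ² c₁(β)² · w_A(y)w_C(y)w_B(y) · e^{−ρ d(y,y′)}` — two compositions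
(`B9Ineq363L2.hasL2Majorant_comp_decay`), the local letters costing their norms.
[cite: Balaban1985BackgroundPropagators, (3.25) p.394 + (3.49) p.399; Balaban1984PropagatorsII, Lemma 2.1 p.234 + (2.52) p.232] -/
theorem hasL2Majorant_word5 (blk : W → g.Site) (d : ℕ) (δ₀ α β ρ r Λ κ₁ κ₂ AA AC AB : ℝ) (wA wC wB : g.Site → ℝ)
    (hwA : ∀ a, 0 ≤ wA a) (hwC : ∀ a, 0 ≤ wC a) (hwB : ∀ a, 0 ≤ wB a)
    (hκ₁ : 0 ≤ κ₁) (hκ₂ : 0 ≤ κ₂) (hAA : 0 ≤ AA) (hAC : 0 ≤ AC) (hAB : 0 ≤ AB) (hΛ : 0 ≤ Λ)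
    (hρ : 0 ≤ ρ) (hr : ρ + (α + β) * δ₀ ≤ r)
    (hdnn : ∀ a b : g.Site, 0 ≤ g.dist a b) (htri : Triangle254 (toB6 g R H))
    (h261 : Ineq261 d (toB6 g R H) δ₀ β)
    (hTB : ScaleTransfer g δ₀ α Λ wB) (hTCB : ScaleTransfer g δ₀ α Λ (fun a => wC a * wB a))
    {A Q₁ C Q₂ B : Module.End ℝ (W → ℝ)}
    (hA : HasL2Majorant (g := toB6 g R H) blk A (fun a b => AA * wA a * Real.exp (-(r * g.dist a b))))
    (hQ₁ : HasL2Majorant (g := toB6 g R H) blk Q₁ (fun a b : g.Site => if a = b then κ₁ else 0))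
    (hC : HasL2Majorant (g := toB6 g R H) blk C (fun a b => AC * wC a * Real.exp (-(r * g.dist a b))))
    (hQ₂ : HasL2Majorant (g := toB6 g R H) blk Q₂ (fun a b : g.Site => if a = b then κ₂ else 0))
    (hB : HasL2Majorant (g := toB6 g R H) blk B (fun a b => AB * wB a * Real.exp (-(ρ * g.dist a b)))) :
    HasL2Majorant (g := toB6 g R H) blk (A * Q₁ * C * Q₂ * B)
      (fun a b => (AA * κ₁ * AC * κ₂ * AB * Λ ^ 2 * B6.c1 d δ₀ β ^ 2) * (wA a * (wC a * wB a)) *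
        Real.exp (-(ρ * g.dist a b))) := by
  have hc0 : 0 ≤ B6.c1 d δ₀ β := B6RandomWalk.c1_nonneg d δ₀ β
  have hwCB : ∀ a, 0 ≤ wC a * wB a := fun a => mul_nonneg (hwC a) (hwB a)
  have hKB : ∀ a b : g.Site, 0 ≤ AB * wB a * Real.exp (-(ρ * g.dist a b)) := fun a b => by
    have := hwB a; positivity
  -- Q₂·B
  have s1 : HasL2Majorant (g := toB6 g R H) blk (Q₂ * B)
      (fun a b => (κ₂ * AB) * wB a * Real.exp (-(ρ * g.dist a b))) :=
    hasL2Majorant_mono (g := toB6 g R H) blk (hasL2Majorant_local_mul (R := R) (H := H) blk κ₂ hκ₂ hQ₂ hB)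
      fun a b => le_of_eq (by ring)
  -- C·(Q₂·B)
  have s2 : HasL2Majorant (g := toB6 g R H) blk (C * (Q₂ * B))
      (fun a b => (AC * (κ₂ * AB) * Λ * B6.c1 d δ₀ β) * (wC a * wB a) * Real.exp (-(ρ * g.dist a b))) :=
    hasL2Majorant_comp_decay (R := R) (H := H) blk d δ₀ α β ρ r Λ AC (κ₂ * AB) wC wB hwC hwB hΛ hAC
      (mul_nonneg hκ₂ hAB) hρ hr hdnn htri hTB h261 hC s1
  have hK2 : ∀ a b : g.Site, 0 ≤ (AC * (κ₂ * AB) * Λ * B6.c1 d δ₀ β) * (wC a * wB a) *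
      Real.exp (-(ρ * g.dist a b)) := fun a b => by
    have := hwCB a; positivity
  -- Q₁·(C·(Q₂·B))
  have s3 : HasL2Majorant (g := toB6 g R H) blk (Q₁ * (C * (Q₂ * B)))
      (fun a b => (κ₁ * (AC * (κ₂ * AB) * Λ * B6.c1 d δ₀ β)) * (wC a * wB a) * Real.exp (-(ρ * g.dist a b))) :=
    hasL2Majorant_mono (g := toB6 g R H) blk (hasL2Majorant_local_mul (R := R) (H := H) blk κ₁ hκ₁ hQ₁ s2)
      fun a b => le_of_eq (by ring)
  -- A·(Q₁·(C·(Q₂·B)))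
  have s4 : HasL2Majorant (g := toB6 g R H) blk (A * (Q₁ * (C * (Q₂ * B))))
      (fun a b => (AA * (κ₁ * (AC * (κ₂ * AB) * Λ * B6.c1 d δ₀ β)) * Λ * B6.c1 d δ₀ β) * (wA a * (wC a * wB a)) *
        Real.exp (-(ρ * g.dist a b))) :=
    hasL2Majorant_comp_decay (R := R) (H := H) blk d δ₀ α β ρ r Λ AA (κ₁ * (AC * (κ₂ * AB) * Λ * B6.c1 d δ₀ β))
      wA (fun a => wC a * wB a) hwA hwCB hΛ hAA (by positivity) hρ hr hdnn htri hTCB h261 hA s3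
  have e : A * Q₁ * C * Q₂ * B = A * (Q₁ * (C * (Q₂ * B))) := by noncomm_ring
  rw [e]
  exact hasL2Majorant_mono (g := toB6 g R H) blk s4 fun a b => le_of_eq (by ring)



/-- **The word `X·Q′*·(Q′G′²Q′*)⁻¹·Q′·Y` of (3.25)** with generic end letters: `X` with majorant `B_X w_X e^{−δ d}`
(`X ∈ {G′, ∇G′}`: `w_X = (Lʲη)², Lʲη` by (3.42)₁,₂), `Y` with `B_Y w_Y e^{−δ d}` (`Y ∈ {G′, G′∇*}`: `w_Y = (Lʲη)², Lʲη` by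
(3.42)₁,₃), `(Q′G′²Q′*)⁻¹` with the (3.48)-majorant `B₁(Lʲη)⁻⁴e^{−δ d}`, `Q′`, `Q′*` block-local with norm `κ_Q`: the word has
the majorant `κ_Q²B_XB₁B_Y Λ⁴c² · w_X(Lʲη)⁻⁴w_Y · e^{−ρ d}` for `ρ + (2α+β)δ₀ ≦ δ`.
[cite: Balaban1985BackgroundPropagators, (3.25) p.394 + (3.42) p.397 + (3.48) p.398 + (3.49) p.399; Balaban1984PropagatorsII, Lemma 2.1 p.234] -/
theorem hasL2Majorant_word349 (blk : W → g.Site) (d : ℕ) (δ₀ δ α β ρ Λ κQ BX B₁ BY : ℝ) (wX wY : g.Site → ℝ)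
    (hwX : ∀ a, 0 ≤ wX a) (hwY : ∀ a, 0 ≤ wY a) (hκQ : 0 ≤ κQ) (hBX : 0 ≤ BX) (hB₁ : 0 ≤ B₁) (hBY : 0 ≤ BY)
    (hΛ : 1 ≤ Λ) (hρ : 0 ≤ ρ) (hα : 0 ≤ α) (hβ : 0 ≤ β) (hδ₀ : 0 ≤ δ₀) (hr : ρ + (2 * α + β) * δ₀ ≤ δ)
    (hdnn : ∀ a b : g.Site, 0 ≤ g.dist a b) (htri : Triangle254 (toB6 g R H))
    (h261 : Ineq261 d (toB6 g R H) δ₀ β)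
    (hTY : ScaleTransfer g δ₀ α Λ wY) (hT4 : ScaleTransfer g δ₀ α Λ (fun a => (g.len a ^ 4)⁻¹))
    {X Y Qs Q Cinv : Module.End ℝ (W → ℝ)}
    (hX : HasL2Majorant (g := toB6 g R H) blk X (fun a b => BX * wX a * Real.exp (-(δ * g.dist a b))))
    (hY : HasL2Majorant (g := toB6 g R H) blk Y (fun a b => BY * wY a * Real.exp (-(δ * g.dist a b))))
    (hQ : HasL2Majorant (g := toB6 g R H) blk Q (fun a b : g.Site => if a = b then κQ else 0))
    (hQs : HasL2Majorant (g := toB6 g R H) blk Qs (fun a b : g.Site => if a = b then κQ else 0))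
    (hCinv : HasL2Majorant (g := toB6 g R H) blk Cinv
      (fun a b => B₁ * (g.len a ^ 4)⁻¹ * Real.exp (-(δ * g.dist a b)))) :
    HasL2Majorant (g := toB6 g R H) blk (X * Qs * Cinv * Q * Y)
      (fun a b => (κQ ^ 2 * BX * B₁ * BY * Λ ^ 4 * B6.c1 d δ₀ β ^ 2) * (wX a * ((g.len a ^ 4)⁻¹ * wY a)) *
        Real.exp (-(ρ * g.dist a b))) := by
  have hw4 : ∀ a : g.Site, 0 ≤ (g.len a ^ 4)⁻¹ := fun a => inv_nonneg.mpr (by positivity)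
  have hρδ : ρ ≤ δ := by nlinarith
  obtain ⟨tY, t4Y⟩ := transfers_word (g := g) hwY hΛ hα hδ₀ hdnn hTY hT4
  have hYρ := hasL2Majorant_rate_mono (R := R) (H := H) blk BY wY hBY hwY hρδ hdnn hY
  have h := hasL2Majorant_word5 (R := R) (H := H) blk d δ₀ (2 * α) β ρ δ (Λ ^ 2) κQ κQ BX B₁ BY wX
    (fun a => (g.len a ^ 4)⁻¹) wY hwX hw4 hwY hκQ hκQ hBX hB₁ hBY (by positivity) hρ hr hdnn htri h261 tY t4Y
    hX hQs hCinv hQ hYρ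
  refine hasL2Majorant_mono (g := toB6 g R H) blk h fun a b => le_of_eq ?_
  ring

/-- **(3.49) p. 399 — *"For the operator P = I − R we obtain, using again Lemma 2.1, [|P(x,x′)|, |(DP)_μ(x,x′)|,
|(PD\*)_ν(x,x′)|, |(DPD\*)_{μν}(x,x′)|] ≦ O(1)[1, (Lʲη)⁻¹, (Lʲη)⁻¹, (Lʲη)⁻²](L^{j′}η)^{−d}e^{−(1/2)δ₀d(y,y′)}"* — in the
block-majorant (operator) form of [4] (2.51), all four entries.**  `P(U) = B9Eq360Vprime.pOp G Qs Cinv Q =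
G′Q′*(Q′G′²Q′*)⁻¹Q′G′` ((3.25)); `D`, `Ds` the derivative letters (`∇_U`, `∇*_U`, elements of the same homogeneous
calculus — bonds are points of `W` with their block map).  INPUTS of printed shape: (3.42)₁ `G′ ≺ B₀(Lʲη)²e^{−δd}`,
(3.42)₂ `∇G′ ≺ B₀Lʲη e^{−δd}` (`hDG`, for the product `D * G`), (3.42)₃ `G′∇* ≺ B₀Lʲη e^{−δd}` (`hGDs`, for `G * Ds`),
(3.48) `(Q′G′²Q′*)⁻¹ ≺₂ B₁(Lʲη)⁻⁴e^{−δd}` (read in block-ℓ² on the carrier), `Q′`, `Q′*` block-local with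
norm `κ_Q`, the scale transfers of the p. 398 remark for the weights `Lʲη`, `(Lʲη)²`, `(Lʲη)⁻⁴` at exponent `α` with
constant `Λ ≧ 1` (`B9Ineq347.scaleTransfer_of_260`), (2.61) at `β`, (2.54), `d ≧ 0`, `Lʲη > 0`.  CONCLUSION, for
`ρ + (2α+β)δ₀ ≦ δ`: majorants `κ₃₄₉·[1, (Lʲη)⁻¹, (Lʲη)⁻¹, (Lʲη)⁻²]·e^{−ρ d(y,y′)}` for `P`, `D·P`, `P·D*`, `D·P·D*`,
`κ₃₄₉ = κ_Q²B₀²B₁Λ⁴c²`.  The same statement with the extended letters (`G′(U′U)`, its (3.42)-majorants with new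
constants, `(Q′G′²Q′*)⁻¹(U′U)` = `B9Ineq366CPrime.inverse_satisfies_thm32_of_parts`, `Q′(U′U)`, `Q′*(U′U)` block-local
with norm `κ_Q + c_Fα₁`) IS p. 403's *"the operator P(U′U) satisfies the bounds (3.49)"*.  LOCATED: this is the
operator (block `L^∞ → L^∞`) form; the printed POINTWISE kernel form is pv16's `B9Ineq349.ineq349_of_thms31to33`
(modulo its kernel-composition dictionary); rate `ρ` vs the printed `½δ₀` as in `B9Ineq349.rates_349`.
[cite: Balaban1985BackgroundPropagators, (3.49) p.399 + (3.25) p.394 + Thm 3.1 (3.42) p.397 + Thm 3.2 (3.48) p.398 + (3.68) p.403; Balaban1984PropagatorsII, Lemma 2.1 p.234] -/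
theorem ineq349_l2 (blk : W → g.Site) (d : ℕ) (δ₀ δ α β ρ Λ κQ B₀ B₁ : ℝ)
    (hκQ : 0 ≤ κQ) (hB₀ : 0 ≤ B₀) (hB₁ : 0 ≤ B₁) (hΛ : 1 ≤ Λ) (hρ : 0 ≤ ρ) (hα : 0 ≤ α) (hβ : 0 ≤ β)
    (hδ₀ : 0 ≤ δ₀) (hr : ρ + (2 * α + β) * δ₀ ≤ δ)
    (hdnn : ∀ a b : g.Site, 0 ≤ g.dist a b) (htri : Triangle254 (toB6 g R H)) (hlen : ∀ y : g.Site, 0 < g.len y)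
    (h261 : Ineq261 d (toB6 g R H) δ₀ β)
    (hT1 : ScaleTransfer g δ₀ α Λ (fun a => g.len a)) (hT2 : ScaleTransfer g δ₀ α Λ (fun a => g.len a ^ 2))
    (hT4 : ScaleTransfer g δ₀ α Λ (fun a => (g.len a ^ 4)⁻¹))
    {G D Ds Qs Q Cinv : Module.End ℝ (W → ℝ)}
    (hQ : HasL2Majorant (g := toB6 g R H) blk Q (fun a b : g.Site => if a = b then κQ else 0))
    (hQs : HasL2Majorant (g := toB6 g R H) blk Qs (fun a b : g.Site => if a = b then κQ else 0))
    (hG : HasL2Majorant (g := toB6 g R H) blk G (fun a b => B₀ * g.len a ^ 2 * Real.exp (-(δ * g.dist a b))))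
    (hDG : HasL2Majorant (g := toB6 g R H) blk (D * G) (fun a b => B₀ * g.len a * Real.exp (-(δ * g.dist a b))))
    (hGDs : HasL2Majorant (g := toB6 g R H) blk (G * Ds) (fun a b => B₀ * g.len a * Real.exp (-(δ * g.dist a b))))
    (hCinv : HasL2Majorant (g := toB6 g R H) blk Cinv
      (fun a b => B₁ * (g.len a ^ 4)⁻¹ * Real.exp (-(δ * g.dist a b)))) :
    HasL2Majorant (g := toB6 g R H) blk (B9Eq360Vprime.pOp G Qs Cinv Q)
        (fun a b => kappa349 κQ B₀ B₁ Λ (B6.c1 d δ₀ β) * Real.exp (-(ρ * g.dist a b))) ∧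
      HasL2Majorant (g := toB6 g R H) blk (D * B9Eq360Vprime.pOp G Qs Cinv Q)
        (fun a b => kappa349 κQ B₀ B₁ Λ (B6.c1 d δ₀ β) * (g.len a)⁻¹ * Real.exp (-(ρ * g.dist a b))) ∧
      HasL2Majorant (g := toB6 g R H) blk (B9Eq360Vprime.pOp G Qs Cinv Q * Ds)
        (fun a b => kappa349 κQ B₀ B₁ Λ (B6.c1 d δ₀ β) * (g.len a)⁻¹ * Real.exp (-(ρ * g.dist a b))) ∧
      HasL2Majorant (g := toB6 g R H) blk (D * B9Eq360Vprime.pOp G Qs Cinv Q * Ds)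
        (fun a b => kappa349 κQ B₀ B₁ Λ (B6.c1 d δ₀ β) * (g.len a ^ 2)⁻¹ * Real.exp (-(ρ * g.dist a b))) := by
  have hw1 : ∀ a : g.Site, 0 ≤ g.len a := fun a => (hlen a).le
  have hw2 : ∀ a : g.Site, 0 ≤ g.len a ^ 2 := fun a => sq_nonneg _
  -- the four words, generic lemma
  have e1 := hasL2Majorant_word349 (R := R) (H := H) blk d δ₀ δ α β ρ Λ κQ B₀ B₁ B₀ (fun a => g.len a ^ 2)
    (fun a => g.len a ^ 2) hw2 hw2 hκQ hB₀ hB₁ hB₀ hΛ hρ hα hβ hδ₀ hr hdnn htri h261 hT2 hT4 hG hG hQ hQs hCinv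
  have e2 := hasL2Majorant_word349 (R := R) (H := H) blk d δ₀ δ α β ρ Λ κQ B₀ B₁ B₀ (fun a => g.len a)
    (fun a => g.len a ^ 2) hw1 hw2 hκQ hB₀ hB₁ hB₀ hΛ hρ hα hβ hδ₀ hr hdnn htri h261 hT2 hT4 hDG hG hQ hQs hCinv
  have e3 := hasL2Majorant_word349 (R := R) (H := H) blk d δ₀ δ α β ρ Λ κQ B₀ B₁ B₀ (fun a => g.len a ^ 2)
    (fun a => g.len a) hw2 hw1 hκQ hB₀ hB₁ hB₀ hΛ hρ hα hβ hδ₀ hr hdnn htri h261 hT1 hT4 hG hGDs hQ hQs hCinv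
  have e4 := hasL2Majorant_word349 (R := R) (H := H) blk d δ₀ δ α β ρ Λ κQ B₀ B₁ B₀ (fun a => g.len a)
    (fun a => g.len a) hw1 hw1 hκQ hB₀ hB₁ hB₀ hΛ hρ hα hβ hδ₀ hr hdnn htri h261 hT1 hT4 hDG hGDs hQ hQs hCinv
  have o1 : B9Eq360Vprime.pOp G Qs Cinv Q = G * Qs * Cinv * Q * G := rfl
  have o2 : D * B9Eq360Vprime.pOp G Qs Cinv Q = D * G * Qs * Cinv * Q * G := by
    rw [o1]; noncomm_ring
  have o3 : B9Eq360Vprime.pOp G Qs Cinv Q * Ds = G * Qs * Cinv * Q * (G * Ds) := by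
    rw [o1]; noncomm_ring
  have o4 : D * B9Eq360Vprime.pOp G Qs Cinv Q * Ds = D * G * Qs * Cinv * Q * (G * Ds) := by
    rw [o1]; noncomm_ring
  refine ⟨?_, ?_, ?_, ?_⟩
  · rw [o1]
    refine hasL2Majorant_mono (g := toB6 g R H) blk e1 fun a b => le_of_eq ?_
    have ha : g.len a ≠ 0 := (hlen a).ne'
    simp only [kappa349]
    field_simp
  · rw [o2]
    refine hasL2Majorant_mono (g := toB6 g R H) blk e2 fun a b => le_of_eq ?_
    have ha : g.len a ≠ 0 := (hlen a).ne'
    simp only [kappa349]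
    field_simp
  · rw [o3]
    refine hasL2Majorant_mono (g := toB6 g R H) blk e3 fun a b => le_of_eq ?_
    have ha : g.len a ≠ 0 := (hlen a).ne'
    simp only [kappa349]
    field_simp
  · rw [o4]
    refine hasL2Majorant_mono (g := toB6 g R H) blk e4 fun a b => le_of_eq ?_
    have ha : g.len a ≠ 0 := (hlen a).ne'
    simp only [kappa349]
    field_simp


end Ineq349

/-! ## §2  (3.68) in block-ℓ²: the five words of `P′(A)` and its two entries -/

section Ineq368

/-- `Λ ≦ Λ²` for `Λ ≧ 1` (plumbing, as in `B9Ineq368PPrime`). [folklore] -/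
private theorem le_sq_of_one_le {Λ : ℝ} (hΛ : 1 ≤ Λ) : Λ ≤ Λ ^ 2 := by nlinarith

variable {g : B9.Geometry} [Fintype g.Site] [DecidableEq g.Site] {R : ℝ} {H : Prop} {W : Type} [Fintype W]

set_option maxHeartbeats 400000 in
/-- **The five words of `P′(A)` (p. 403 *"The remainder can be written explicitly in terms of the operators introduced
until now"*, `B9Eq360Vprime.pPrime_explicit`) with a generic left end letter `X`** (`X = G′(U)`: entry `|P′|`;
`X = ∇G′(U)`: entry `|DP′|`): `X·V′G′(U′U)·Q′*(U′U)·C⁻¹(U′U)·Q′(U′U)·G′(U′U) + X·F′₂*·C⁻¹(U′U)·Q′(U′U)·G′(U′U) −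
X·Q′*·(C⁻¹(U′U)C′(A)C⁻¹(U))·Q′(U′U)·G′(U′U) + X·Q′*·C⁻¹(U)·F′₂·G′(U′U) + X·Q′*·C⁻¹(U)·Q′·G′(U)V′G′(U′U)`
(`C⁻¹ = (Q′G′²Q′*)⁻¹`) has the majorant `κ₃₆₈·α₁·w_X(Lʲη)⁻²·e^{−ρ d}` for `ρ + 2(2α+β)δ₀ ≦ δ`.  INPUTS of printed shape:
(3.42)₁ for `G′(U)`, `G′(U′U)` and the majorant of `X`; (3.48) for `C⁻¹(U)` and for `C⁻¹(U′U)` (the latter =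
`B9Ineq366CPrime.inverse_satisfies_thm32_of_parts`); (3.57) `Q′(U′U) = Q′ + F′₂`, `Q′*(U′U) = Q′* + F′₂*` with (3.59)
(block-local, `c_Fα₁`) and (3.19) (block-local, `κ_Q`); (3.63) for `V′G′(U′U)`; (3.66) for `C′(A)` (`B9Ineq366CPrime`:
`κ_Cα₁(Lʲη)⁴e^{−δd}`); all at a common rate `δ`; Lemma 2.1 of [4] (scale transfers for `(Lʲη)²`, `(Lʲη)⁻⁴` at `α` with
`Λ ≧ 1`, (2.61) at `β`, (2.54)).  Every word carries exactly one small factor (`c_Vα₁`, `c_Fα₁`, `κ_Cα₁`).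
[cite: Balaban1985BackgroundPropagators, (3.68) p.403 + (3.57)–(3.59) pp.401–402 + (3.63)–(3.67) pp.402–403 + Thm 3.1/3.2 pp.397–398; Balaban1984PropagatorsII, Lemma 2.1 p.234] -/
theorem hasL2Majorant_pPrime_words (blk : W → g.Site) (d : ℕ)
    (δ₀ δ α β ρ Λ κQ cF cV κC BG BX BE Bc Bc' α₁ : ℝ) (wX : g.Site → ℝ)
    (hwX : ∀ a, 0 ≤ wX a) (hκQ : 0 ≤ κQ) (hcF : 0 ≤ cF) (hcV : 0 ≤ cV) (hκC : 0 ≤ κC) (hBG : 0 ≤ BG)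
    (hBX : 0 ≤ BX) (hBE : 0 ≤ BE) (hBc : 0 ≤ Bc) (hBc' : 0 ≤ Bc') (hα₁ : 0 ≤ α₁)
    (hΛ : 1 ≤ Λ) (hρ : 0 ≤ ρ) (hα : 0 ≤ α) (hβ : 0 ≤ β) (hδ₀ : 0 ≤ δ₀) (hr : ρ + 2 * ((2 * α + β) * δ₀) ≤ δ)
    (hdnn : ∀ a b : g.Site, 0 ≤ g.dist a b) (htri : Triangle254 (toB6 g R H)) (hlen : ∀ y : g.Site, 0 < g.len y)
    (h261 : Ineq261 d (toB6 g R H) δ₀ β)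
    (hT2 : ScaleTransfer g δ₀ α Λ (fun a => g.len a ^ 2)) (hT4 : ScaleTransfer g δ₀ α Λ (fun a => (g.len a ^ 4)⁻¹))
    {X G E V Qs Q Qs' Q' F₂ F₂s Cinv Cinv' Cp : Module.End ℝ (W → ℝ)}
    (h357 : Q' = Q + F₂) (h357s : Qs' = Qs + F₂s)
    (hX : HasL2Majorant (g := toB6 g R H) blk X (fun a b => BX * wX a * Real.exp (-(δ * g.dist a b))))
    (hG : HasL2Majorant (g := toB6 g R H) blk G (fun a b => BG * g.len a ^ 2 * Real.exp (-(δ * g.dist a b))))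
    (hE : HasL2Majorant (g := toB6 g R H) blk E (fun a b => BE * g.len a ^ 2 * Real.exp (-(δ * g.dist a b))))
    (hVE : HasL2Majorant (g := toB6 g R H) blk (V * E) (fun a b => cV * α₁ * BE * Real.exp (-(δ * g.dist a b))))
    (hQ : HasL2Majorant (g := toB6 g R H) blk Q (fun a b : g.Site => if a = b then κQ else 0))
    (hQs : HasL2Majorant (g := toB6 g R H) blk Qs (fun a b : g.Site => if a = b then κQ else 0))
    (hF : HasL2Majorant (g := toB6 g R H) blk F₂ (fun a b : g.Site => if a = b then cF * α₁ else 0))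
    (hFs : HasL2Majorant (g := toB6 g R H) blk F₂s (fun a b : g.Site => if a = b then cF * α₁ else 0))
    (hCinv : HasL2Majorant (g := toB6 g R H) blk Cinv
      (fun a b => Bc * (g.len a ^ 4)⁻¹ * Real.exp (-(δ * g.dist a b))))
    (hCinv' : HasL2Majorant (g := toB6 g R H) blk Cinv'
      (fun a b => Bc' * (g.len a ^ 4)⁻¹ * Real.exp (-(δ * g.dist a b))))
    (hCp : HasL2Majorant (g := toB6 g R H) blk Cp
      (fun a b => κC * α₁ * g.len a ^ 4 * Real.exp (-(δ * g.dist a b)))) :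
    HasL2Majorant (g := toB6 g R H) blk
      (X * V * E * Qs' * Cinv' * Q' * E + X * F₂s * Cinv' * Q' * E - X * Qs * (Cinv' * Cp * Cinv) * Q' * E
        + X * Qs * Cinv * F₂ * E + X * Qs * Cinv * Q * (G * V * E))
      (fun a b => kappa368 κQ cF cV κC BG BX BE Bc Bc' Λ (B6.c1 d δ₀ β) α₁ * α₁ * (wX a * (g.len a ^ 2)⁻¹) *
        Real.exp (-(ρ * g.dist a b))) := by
  -- constants and rates
  have hc0 : 0 ≤ B6.c1 d δ₀ β := B6RandomWalk.c1_nonneg d δ₀ β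
  have hw2 : ∀ a : g.Site, 0 ≤ g.len a ^ 2 := fun a => sq_nonneg _
  have hw4p : ∀ a : g.Site, 0 ≤ g.len a ^ 4 := fun a => by positivity
  have hw4 : ∀ a : g.Site, 0 ≤ (g.len a ^ 4)⁻¹ := fun a => inv_nonneg.mpr (hw4p a)
  have hΛ0 : 0 ≤ Λ := zero_le_one.trans hΛ
  have hεnn : 0 ≤ (2 * α + β) * δ₀ := by positivity
  set r : ℝ := ρ + (2 * α + β) * δ₀ with hr_def
  have hρr : ρ ≤ r := by rw [hr_def]; linarith
  have hr0 : 0 ≤ r := hρ.trans hρr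
  have hrδ : r + (2 * α + β) * δ₀ ≤ δ := by rw [hr_def]; linarith
  have hrδ' : r ≤ δ := by linarith
  have hρδ : ρ ≤ δ := hρr.trans hrδ'
  have hρr' : ρ + (2 * α + β) * δ₀ ≤ r := le_of_eq hr_def.symm
  have hρδ'' : ρ + (2 * α + β) * δ₀ ≤ δ := hρr'.trans hrδ'
  have hαδ : 0 ≤ 2 * α * δ₀ := by positivity
  have hcFα : 0 ≤ cF * α₁ := mul_nonneg hcF hα₁
  have hcVα : 0 ≤ cV * α₁ * BE := by positivity
  -- scale transfers at exponent 2α, constant Λ²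
  obtain ⟨t2, t42⟩ := transfers_word (g := g) hw2 hΛ hα hδ₀ hdnn hT2 hT4
  have t4 : ScaleTransfer g δ₀ (2 * α) (Λ ^ 2) (fun a => (g.len a ^ 4)⁻¹) :=
    scaleTransfer_const_mono hw4 (le_sq_of_one_le hΛ) (scaleTransfer_exp_mono hw4 (by linarith) hδ₀ hdnn hT4)
  -- weakened letters
  have hXr := hasL2Majorant_rate_mono (R := R) (H := H) blk BX wX hBX hwX hrδ' hdnn hX
  have hEρ := hasL2Majorant_rate_mono (R := R) (H := H) blk BE (fun a => g.len a ^ 2) hBE hw2 hρδ hdnn hE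
  have hCinvr := hasL2Majorant_rate_mono (R := R) (H := H) blk Bc (fun a => (g.len a ^ 4)⁻¹) hBc hw4 hrδ' hdnn hCinv
  have hCinv'r := hasL2Majorant_rate_mono (R := R) (H := H) blk Bc' (fun a => (g.len a ^ 4)⁻¹) hBc' hw4 hrδ' hdnn
    hCinv'
  have hVEr : HasL2Majorant (g := toB6 g R H) blk (V * E) (fun a b => cV * α₁ * BE * Real.exp (-(r * g.dist a b))) :=
    hasL2Majorant_mono (g := toB6 g R H) blk hVE fun a b =>
      mul_le_mul_of_nonneg_left (Real.exp_le_exp.mpr (by nlinarith [hdnn a b])) hcVα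
  have hVEρ : HasL2Majorant (g := toB6 g R H) blk (V * E) (fun a b => cV * α₁ * BE * Real.exp (-(ρ * g.dist a b))) :=
    hasL2Majorant_mono (g := toB6 g R H) blk hVE fun a b =>
      mul_le_mul_of_nonneg_left (Real.exp_le_exp.mpr (by nlinarith [hdnn a b])) hcVα
  -- the block-local letters Q′(U′U), Q′*(U′U) of (3.57)
  have hQ' : HasL2Majorant (g := toB6 g R H) blk Q' (fun a b : g.Site => if a = b then κQ + cF * α₁ else 0) := by
    rw [h357]; exact hasL2Majorant_local_add (R := R) (H := H) blk κQ (cF * α₁) hQ hF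
  have hQs' : HasL2Majorant (g := toB6 g R H) blk Qs' (fun a b : g.Site => if a = b then κQ + cF * α₁ else 0) := by
    rw [h357s]; exact hasL2Majorant_local_add (R := R) (H := H) blk κQ (cF * α₁) hQs hFs
  have hκ' : 0 ≤ κQ + cF * α₁ := add_nonneg hκQ hcFα
  -- W1 = (X·V′E)·Qs′·Cinv′·Q′·E
  have hA1 : HasL2Majorant (g := toB6 g R H) blk (X * V * E)
      (fun a b => (BX * (cV * α₁ * BE) * B6.c1 d δ₀ β) * wX a * Real.exp (-(r * g.dist a b))) := by
    rw [mul_assoc]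
    exact hasL2Majorant_comp_decay_right1 (R := R) (H := H) blk d δ₀ (2 * α) β r δ BX (cV * α₁ * BE) wX hwX hBX
      hcVα hr0 hαδ hrδ hdnn htri h261 hX hVEr
  have hW1 := hasL2Majorant_word5 (R := R) (H := H) blk d δ₀ (2 * α) β ρ r (Λ ^ 2) (κQ + cF * α₁) (κQ + cF * α₁)
    (BX * (cV * α₁ * BE) * B6.c1 d δ₀ β) Bc' BE wX (fun a => (g.len a ^ 4)⁻¹) (fun a => g.len a ^ 2) hwX hw4 hw2
    hκ' hκ' (by positivity) hBc' hBE (by positivity) hρ hρr' hdnn htri h261 t2 t42 hA1 hQs' hCinv'r hQ' hEρ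
  -- W2 = X·F′₂*·Cinv′·Q′·E
  have hW2 := hasL2Majorant_word5 (R := R) (H := H) blk d δ₀ (2 * α) β ρ r (Λ ^ 2) (cF * α₁) (κQ + cF * α₁)
    BX Bc' BE wX (fun a => (g.len a ^ 4)⁻¹) (fun a => g.len a ^ 2) hwX hw4 hw2
    hcFα hκ' hBX hBc' hBE (by positivity) hρ hρr' hdnn htri h261 t2 t42 hXr hFs hCinv'r hQ' hEρ
  -- W3 = X·Q′*·(Cinv′·C′·Cinv)·Q′·E
  have t1 : HasL2Majorant (g := toB6 g R H) blk (Cp * Cinv)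
      (fun a b => (κC * α₁ * Bc * Λ ^ 2 * B6.c1 d δ₀ β) * (g.len a ^ 4 * (g.len a ^ 4)⁻¹) *
        Real.exp (-(r * g.dist a b))) :=
    hasL2Majorant_comp_decay (R := R) (H := H) blk d δ₀ (2 * α) β r δ (Λ ^ 2) (κC * α₁) Bc (fun a => g.len a ^ 4)
      (fun a => (g.len a ^ 4)⁻¹) hw4p hw4 (by positivity) (mul_nonneg hκC hα₁) hBc hr0 hrδ hdnn htri t4 h261 hCp
      hCinvr
  have t1' : HasL2Majorant (g := toB6 g R H) blk (Cp * Cinv)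
      (fun a b => (κC * α₁ * Bc * Λ ^ 2 * B6.c1 d δ₀ β) * Real.exp (-(r * g.dist a b))) := by
    refine hasL2Majorant_mono (g := toB6 g R H) blk t1 fun a b => le_of_eq ?_
    have ha : g.len a ≠ 0 := (hlen a).ne'
    field_simp
  have t3 : HasL2Majorant (g := toB6 g R H) blk (Cinv' * (Cp * Cinv))
      (fun a b => (Bc' * (κC * α₁ * Bc * Λ ^ 2 * B6.c1 d δ₀ β) * B6.c1 d δ₀ β) * (g.len a ^ 4)⁻¹ *
        Real.exp (-(r * g.dist a b))) :=
    hasL2Majorant_comp_decay_right1 (R := R) (H := H) blk d δ₀ (2 * α) β r δ Bc' (κC * α₁ * Bc * Λ ^ 2 * B6.c1 d δ₀ β)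
      (fun a => (g.len a ^ 4)⁻¹) hw4 hBc' (by positivity) hr0 hαδ hrδ hdnn htri h261 hCinv' t1'
  have hC3 : HasL2Majorant (g := toB6 g R H) blk (Cinv' * Cp * Cinv)
      (fun a b => (Bc' * (κC * α₁ * Bc * Λ ^ 2 * B6.c1 d δ₀ β) * B6.c1 d δ₀ β) * (g.len a ^ 4)⁻¹ *
        Real.exp (-(r * g.dist a b))) := by
    rw [mul_assoc]; exact t3
  have hW3 := hasL2Majorant_word5 (R := R) (H := H) blk d δ₀ (2 * α) β ρ r (Λ ^ 2) κQ (κQ + cF * α₁)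
    BX (Bc' * (κC * α₁ * Bc * Λ ^ 2 * B6.c1 d δ₀ β) * B6.c1 d δ₀ β) BE wX (fun a => (g.len a ^ 4)⁻¹)
    (fun a => g.len a ^ 2) hwX hw4 hw2 hκQ hκ' hBX (by positivity) hBE (by positivity) hρ hρr' hdnn htri h261 t2 t42
    hXr hQs hC3 hQ' hEρ
  -- W4 = X·Q′*·Cinv·F′₂·E
  have hW4 := hasL2Majorant_word5 (R := R) (H := H) blk d δ₀ (2 * α) β ρ r (Λ ^ 2) κQ (cF * α₁)
    BX Bc BE wX (fun a => (g.len a ^ 4)⁻¹) (fun a => g.len a ^ 2) hwX hw4 hw2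
    hκQ hcFα hBX hBc hBE (by positivity) hρ hρr' hdnn htri h261 t2 t42 hXr hQs hCinvr hF hEρ
  -- W5 = X·Q′*·Cinv·Q′·(G′V′E)
  have hB5 : HasL2Majorant (g := toB6 g R H) blk (G * V * E)
      (fun a b => (BG * (cV * α₁ * BE) * B6.c1 d δ₀ β) * g.len a ^ 2 * Real.exp (-(ρ * g.dist a b))) := by
    rw [mul_assoc]
    exact hasL2Majorant_comp_decay_right1 (R := R) (H := H) blk d δ₀ (2 * α) β ρ δ BG (cV * α₁ * BE)
      (fun a => g.len a ^ 2) hw2 hBG hcVα hρ hαδ hρδ'' hdnn htri h261 hG hVEρ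
  have hW5 := hasL2Majorant_word5 (R := R) (H := H) blk d δ₀ (2 * α) β ρ r (Λ ^ 2) κQ κQ
    BX Bc (BG * (cV * α₁ * BE) * B6.c1 d δ₀ β) wX (fun a => (g.len a ^ 4)⁻¹) (fun a => g.len a ^ 2) hwX hw4 hw2
    hκQ hκQ hBX hBc (by positivity) (by positivity) hρ hρr' hdnn htri h261 t2 t42 hXr hQs hCinvr hQ hB5
  -- the signed sum
  have hsum := hasL2Majorant_add (g := toB6 g R H) blk (hasL2Majorant_add (g := toB6 g R H) blk
    (hasL2Majorant_sub (R := R) (H := H) blk (hasL2Majorant_add (g := toB6 g R H) blk hW1 hW2) hW3) hW4) hW5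
  refine hasL2Majorant_mono (g := toB6 g R H) blk hsum fun a b => le_of_eq ?_
  have ha : g.len a ≠ 0 := (hlen a).ne'
  simp only [kappa368]
  field_simp

/-- **(3.68) p. 403, first entry, block-majorant form** — *"Moreover we have |P′(A;x,x′)|, … ≦ O(1)α₁[1, …](L^{j′}η)^{−d}
e^{−(1/2)δ₀d(y,y′)} for x ∈ Δ(y), y ∈ Λ_j, x′ ∈ Δ(y′), y′ ∈ Λ_{j′}. (3.68) The remainder can be written explicitly in terms of
the operators introduced until now by writing the expansions of the operators determining P(U′U)."*: for
`P′(A) = B9Eq360Vprime.pPrime G E Qs Qs' Cinv Cinv' Q Q'` (DEFINED by `P(U′U) = P(U) + P′(A)`), given the expansions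
(3.57) (`h357`, `h357s`), (3.65)₁ (`h365`) and (3.67) in resolvent form (`hC`, `B9Eq360Vprime.inv_sub_inv_of_367`) — so that
`pPrime_explicit` rewrites `P′(A)` as the five words of `hasL2Majorant_pPrime_words` — and the printed-shape inputs listed
there: `P′(A) ≺ κ₃₆₈·α₁·e^{−ρ d(y,y′)}` (weight `(Lʲη)⁰ = 1`, the printed `[1, …]`), `ρ + 2(2α+β)δ₀ ≦ δ`.
[cite: Balaban1985BackgroundPropagators, (3.68) p.403] -/
theorem ineq368_l2 (blk : W → g.Site) (d : ℕ) (δ₀ δ α β ρ Λ κQ cF cV κC BG BE Bc Bc' α₁ : ℝ)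
    (hκQ : 0 ≤ κQ) (hcF : 0 ≤ cF) (hcV : 0 ≤ cV) (hκC : 0 ≤ κC) (hBG : 0 ≤ BG) (hBE : 0 ≤ BE) (hBc : 0 ≤ Bc)
    (hBc' : 0 ≤ Bc') (hα₁ : 0 ≤ α₁) (hΛ : 1 ≤ Λ) (hρ : 0 ≤ ρ) (hα : 0 ≤ α) (hβ : 0 ≤ β) (hδ₀ : 0 ≤ δ₀)
    (hr : ρ + 2 * ((2 * α + β) * δ₀) ≤ δ)
    (hdnn : ∀ a b : g.Site, 0 ≤ g.dist a b) (htri : Triangle254 (toB6 g R H)) (hlen : ∀ y : g.Site, 0 < g.len y)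
    (h261 : Ineq261 d (toB6 g R H) δ₀ β)
    (hT2 : ScaleTransfer g δ₀ α Λ (fun a => g.len a ^ 2)) (hT4 : ScaleTransfer g δ₀ α Λ (fun a => (g.len a ^ 4)⁻¹))
    {G E V Qs Q Qs' Q' F₂ F₂s Cinv Cinv' Cp : Module.End ℝ (W → ℝ)}
    (h357 : Q' = Q + F₂) (h357s : Qs' = Qs + F₂s) (h365 : E = G + G * V * E)
    (hC : Cinv' - Cinv = -(Cinv' * Cp * Cinv))
    (hG : HasL2Majorant (g := toB6 g R H) blk G (fun a b => BG * g.len a ^ 2 * Real.exp (-(δ * g.dist a b))))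
    (hE : HasL2Majorant (g := toB6 g R H) blk E (fun a b => BE * g.len a ^ 2 * Real.exp (-(δ * g.dist a b))))
    (hVE : HasL2Majorant (g := toB6 g R H) blk (V * E) (fun a b => cV * α₁ * BE * Real.exp (-(δ * g.dist a b))))
    (hQ : HasL2Majorant (g := toB6 g R H) blk Q (fun a b : g.Site => if a = b then κQ else 0))
    (hQs : HasL2Majorant (g := toB6 g R H) blk Qs (fun a b : g.Site => if a = b then κQ else 0))
    (hF : HasL2Majorant (g := toB6 g R H) blk F₂ (fun a b : g.Site => if a = b then cF * α₁ else 0))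
    (hFs : HasL2Majorant (g := toB6 g R H) blk F₂s (fun a b : g.Site => if a = b then cF * α₁ else 0))
    (hCinv : HasL2Majorant (g := toB6 g R H) blk Cinv
      (fun a b => Bc * (g.len a ^ 4)⁻¹ * Real.exp (-(δ * g.dist a b))))
    (hCinv' : HasL2Majorant (g := toB6 g R H) blk Cinv'
      (fun a b => Bc' * (g.len a ^ 4)⁻¹ * Real.exp (-(δ * g.dist a b))))
    (hCp : HasL2Majorant (g := toB6 g R H) blk Cp
      (fun a b => κC * α₁ * g.len a ^ 4 * Real.exp (-(δ * g.dist a b)))) :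
    HasL2Majorant (g := toB6 g R H) blk (B9Eq360Vprime.pPrime G E Qs Qs' Cinv Cinv' Q Q')
      (fun a b => kappa368 κQ cF cV κC BG BG BE Bc Bc' Λ (B6.c1 d δ₀ β) α₁ * α₁ * Real.exp (-(ρ * g.dist a b))) := by
  have hw2 : ∀ a : g.Site, 0 ≤ g.len a ^ 2 := fun a => sq_nonneg _
  rw [B9Eq360Vprime.pPrime_explicit G E Qs Qs' Cinv Cinv' Q Q' V F₂ F₂s Cp h365 h357 h357s hC]
  have h := hasL2Majorant_pPrime_words (R := R) (H := H) blk d δ₀ δ α β ρ Λ κQ cF cV κC BG BG BE Bc Bc' α₁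
    (fun a => g.len a ^ 2) hw2 hκQ hcF hcV hκC hBG hBG hBE hBc hBc' hα₁ hΛ hρ hα hβ hδ₀ hr hdnn htri hlen h261 hT2 hT4
    h357 h357s hG hG hE hVE hQ hQs hF hFs hCinv hCinv' hCp
  refine hasL2Majorant_mono (g := toB6 g R H) blk h fun a b => le_of_eq ?_
  have ha : g.len a ≠ 0 := (hlen a).ne'
  field_simp

/-- **(3.68) p. 403, second entry `|(DP′(A))_μ(x,x′)| ≦ O(1)α₁(Lʲη)⁻¹(…)`, block-majorant form**: the same with the
derivative letter on the left, `D·P′(A) ≺ κ₃₆₈·α₁·(Lʲη)⁻¹·e^{−ρ d}`, the left end letter being `∇G′(U)` with its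
(3.42)₂-majorant `B_D Lʲη e^{−δd}` (`hDG`).  NOT typed here: the entries `P′D*`, `DP′D*` — their last word
`G′Q′*C⁻¹Q′·(G′(U′U) − G′(U))∇*` needs (3.61) on arguments of the form `G′∇*λ`, i.e. the Hölder entry (3.44) (cell
GAPS G-B9-02), outside the block-sup calculus. [cite: Balaban1985BackgroundPropagators, (3.68) p.403 + (3.42) p.397 + (3.44) p.398] -/
theorem ineq368_l2_D (blk : W → g.Site) (d : ℕ) (δ₀ δ α β ρ Λ κQ cF cV κC BG BD BE Bc Bc' α₁ : ℝ)
    (hκQ : 0 ≤ κQ) (hcF : 0 ≤ cF) (hcV : 0 ≤ cV) (hκC : 0 ≤ κC) (hBG : 0 ≤ BG) (hBD : 0 ≤ BD) (hBE : 0 ≤ BE)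
    (hBc : 0 ≤ Bc) (hBc' : 0 ≤ Bc') (hα₁ : 0 ≤ α₁) (hΛ : 1 ≤ Λ) (hρ : 0 ≤ ρ) (hα : 0 ≤ α) (hβ : 0 ≤ β)
    (hδ₀ : 0 ≤ δ₀) (hr : ρ + 2 * ((2 * α + β) * δ₀) ≤ δ)
    (hdnn : ∀ a b : g.Site, 0 ≤ g.dist a b) (htri : Triangle254 (toB6 g R H)) (hlen : ∀ y : g.Site, 0 < g.len y)
    (h261 : Ineq261 d (toB6 g R H) δ₀ β)
    (hT2 : ScaleTransfer g δ₀ α Λ (fun a => g.len a ^ 2)) (hT4 : ScaleTransfer g δ₀ α Λ (fun a => (g.len a ^ 4)⁻¹))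
    {G D E V Qs Q Qs' Q' F₂ F₂s Cinv Cinv' Cp : Module.End ℝ (W → ℝ)}
    (h357 : Q' = Q + F₂) (h357s : Qs' = Qs + F₂s) (h365 : E = G + G * V * E)
    (hC : Cinv' - Cinv = -(Cinv' * Cp * Cinv))
    (hG : HasL2Majorant (g := toB6 g R H) blk G (fun a b => BG * g.len a ^ 2 * Real.exp (-(δ * g.dist a b))))
    (hDG : HasL2Majorant (g := toB6 g R H) blk (D * G) (fun a b => BD * g.len a * Real.exp (-(δ * g.dist a b))))
    (hE : HasL2Majorant (g := toB6 g R H) blk E (fun a b => BE * g.len a ^ 2 * Real.exp (-(δ * g.dist a b))))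
    (hVE : HasL2Majorant (g := toB6 g R H) blk (V * E) (fun a b => cV * α₁ * BE * Real.exp (-(δ * g.dist a b))))
    (hQ : HasL2Majorant (g := toB6 g R H) blk Q (fun a b : g.Site => if a = b then κQ else 0))
    (hQs : HasL2Majorant (g := toB6 g R H) blk Qs (fun a b : g.Site => if a = b then κQ else 0))
    (hF : HasL2Majorant (g := toB6 g R H) blk F₂ (fun a b : g.Site => if a = b then cF * α₁ else 0))
    (hFs : HasL2Majorant (g := toB6 g R H) blk F₂s (fun a b : g.Site => if a = b then cF * α₁ else 0))
    (hCinv : HasL2Majorant (g := toB6 g R H) blk Cinv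
      (fun a b => Bc * (g.len a ^ 4)⁻¹ * Real.exp (-(δ * g.dist a b))))
    (hCinv' : HasL2Majorant (g := toB6 g R H) blk Cinv'
      (fun a b => Bc' * (g.len a ^ 4)⁻¹ * Real.exp (-(δ * g.dist a b))))
    (hCp : HasL2Majorant (g := toB6 g R H) blk Cp
      (fun a b => κC * α₁ * g.len a ^ 4 * Real.exp (-(δ * g.dist a b)))) :
    HasL2Majorant (g := toB6 g R H) blk (D * B9Eq360Vprime.pPrime G E Qs Qs' Cinv Cinv' Q Q')
      (fun a b => kappa368 κQ cF cV κC BG BD BE Bc Bc' Λ (B6.c1 d δ₀ β) α₁ * α₁ * (g.len a)⁻¹ *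
        Real.exp (-(ρ * g.dist a b))) := by
  have hw1 : ∀ a : g.Site, 0 ≤ g.len a := fun a => (hlen a).le
  rw [B9Eq360Vprime.pPrime_explicit G E Qs Qs' Cinv Cinv' Q Q' V F₂ F₂s Cp h365 h357 h357s hC]
  have e : D * (G * V * E * Qs' * Cinv' * Q' * E + G * F₂s * Cinv' * Q' * E - G * Qs * (Cinv' * Cp * Cinv) * Q' * E
        + G * Qs * Cinv * F₂ * E + G * Qs * Cinv * Q * (G * V * E))
      = D * G * V * E * Qs' * Cinv' * Q' * E + D * G * F₂s * Cinv' * Q' * E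
        - D * G * Qs * (Cinv' * Cp * Cinv) * Q' * E + D * G * Qs * Cinv * F₂ * E
        + D * G * Qs * Cinv * Q * (G * V * E) := by
    simp only [mul_add, mul_sub, mul_assoc]
  rw [e]
  have h := hasL2Majorant_pPrime_words (R := R) (H := H) blk d δ₀ δ α β ρ Λ κQ cF cV κC BG BD BE Bc Bc' α₁
    (fun a => g.len a) hw1 hκQ hcF hcV hκC hBG hBD hBE hBc hBc' hα₁ hΛ hρ hα hβ hδ₀ hr hdnn htri hlen h261 hT2 hT4
    h357 h357s hDG hG hE hVE hQ hQs hF hFs hCinv hCinv' hCp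
  refine hasL2Majorant_mono (g := toB6 g R H) blk h fun a b => le_of_eq ?_
  have ha : g.len a ≠ 0 := (hlen a).ne'
  field_simp


end Ineq368

/-! ## §3  (3.77) in block-ℓ²: the seven words of `P₁(A)` -/

section Ineq377

variable {g : B9.Geometry} [Fintype g.Site] {R : ℝ} {H : Prop} {W : Type} [Fintype W]

/-- **(3.77) p. 406 — «the operator P₁(A) is a non-local operator whose kernel satisfies the bound |P_{1,μν}(A;x,x′)| ≦
O(1)α₁(Lʲη)⁻²(L^{j′}η)^{−d}e^{−(1/2)δ₀d(y,y′)}» — in the block-majorant (operator) form of [4] (2.51).**  LETTERS (one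
homogeneous calculus, `W` ∋ sites, bonds, blocks): `D = D_U`, `Ds = D*_U`, `D′ = D_{U′U} = D + E`, `Ds′ = D*_{U′U} = Ds + Es`
((3.70)/(3.74)), `P = P(U) = I − R(U)`, `Pp = P′(A)` ((3.68): `P(U′U) = P + P′`); `P₁(A) = B9Eq386Neumann.pOne D D′ Ds Ds′ P Pp`
((3.76)).  INPUTS of printed shape, all at a common rate `δ`: (3.49) for `P`, `D·P`, `P·D*` (constant `κ_P`; the fourth
entry `D·P·D*` is not needed); (3.68) for `P′`, `D·P′`, `P′·D*`, `D·P′·D*` (constant `κ_{P′}α₁`); the first-order local letters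
`E`, `Es` with majorant `c_Eα₁(Lʲη)⁻¹e^{−δd}` («η⁻¹[exp(ηi ad_{RA}) − 1]R(U)·» of (3.70)/(3.74), sup-size `O(1)|A| ≦
O(1)α₁(Lʲη)⁻¹` by (3.37)); Lemma 2.1 of [4]: the scale transfer of the weight `(Lʲη)⁻¹` at exponent `α` with constant `Λ`
(`B9Ineq347.scaleTransfer_of_260`), (2.61) at exponent `β`, the triangle inequality (2.54), `d ≧ 0`, `Lʲη > 0`.  CONCLUSION:
for every `ρ ≧ 0` with `ρ + 2(α+β)δ₀ ≦ δ` (two nesting levels of compositions in the words `E·P·E*`, `E·P′·E*`),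
`P₁(A) ≺ κ₃₇₇·α₁·(Lʲη)⁻²·e^{−ρ d(y,y′)}` — i.e. `|(P₁(A)λ)(x)| ≦ κ₃₇₇α₁(Lʲη)⁻²e^{−ρd(y,y′)}|λ|` for `x ∈ Δ(y)`, `supp λ ⊂
Δ(y′)`, with `κ₃₇₇` EXPLICIT (`kappa377`).  Route = the print's «These expansions imply»: expand (§1), bound each of the seven
words by [4] (2.52)–(2.55) + (2.68) (`B9Ineq363L2.hasL2Majorant_comp_decay`), add.
[cite: Balaban1985BackgroundPropagators, (3.76)–(3.77) pp.405–406 + (3.49) p.399 + (3.68) p.403 + (3.70)/(3.74) pp.404–405 + (3.37) p.396; Balaban1984PropagatorsII, Lemma 2.1 p.234 + (2.52)–(2.55) p.232] -/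
theorem ineq377_l2 (blk : W → g.Site) (d : ℕ) (δ₀ δ α β ρ Λ cE κP κP' α₁ : ℝ)
    (hcE : 0 ≤ cE) (hκP : 0 ≤ κP) (hκP' : 0 ≤ κP') (hα₁ : 0 ≤ α₁) (hΛ : 1 ≤ Λ) (hρ : 0 ≤ ρ) (hα : 0 ≤ α)
    (hβ : 0 ≤ β) (hδ₀ : 0 ≤ δ₀) (hr : ρ + 2 * ((α + β) * δ₀) ≤ δ)
    (hdnn : ∀ a b : g.Site, 0 ≤ g.dist a b) (htri : Triangle254 (toB6 g R H)) (hlen : ∀ y : g.Site, 0 < g.len y)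
    (h261 : Ineq261 d (toB6 g R H) δ₀ β) (hT1i : ScaleTransfer g δ₀ α Λ (fun a => (g.len a)⁻¹))
    {D D' Ds Ds' E Es P Pp : Module.End ℝ (W → ℝ)} (hD' : D' = D + E) (hDs' : Ds' = Ds + Es)
    (hP : HasL2Majorant (g := toB6 g R H) blk P (fun a b => κP * Real.exp (-(δ * g.dist a b))))
    (hDP : HasL2Majorant (g := toB6 g R H) blk (D * P) (fun a b => κP * (g.len a)⁻¹ * Real.exp (-(δ * g.dist a b))))
    (hPDs : HasL2Majorant (g := toB6 g R H) blk (P * Ds) (fun a b => κP * (g.len a)⁻¹ * Real.exp (-(δ * g.dist a b))))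
    (hPp : HasL2Majorant (g := toB6 g R H) blk Pp (fun a b => κP' * α₁ * Real.exp (-(δ * g.dist a b))))
    (hDPp : HasL2Majorant (g := toB6 g R H) blk (D * Pp)
      (fun a b => κP' * α₁ * (g.len a)⁻¹ * Real.exp (-(δ * g.dist a b))))
    (hPpDs : HasL2Majorant (g := toB6 g R H) blk (Pp * Ds)
      (fun a b => κP' * α₁ * (g.len a)⁻¹ * Real.exp (-(δ * g.dist a b))))
    (hDPpDs : HasL2Majorant (g := toB6 g R H) blk (D * Pp * Ds)
      (fun a b => κP' * α₁ * (g.len a ^ 2)⁻¹ * Real.exp (-(δ * g.dist a b))))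
    (hE : HasL2Majorant (g := toB6 g R H) blk E (fun a b => cE * α₁ * (g.len a)⁻¹ * Real.exp (-(δ * g.dist a b))))
    (hEs : HasL2Majorant (g := toB6 g R H) blk Es (fun a b => cE * α₁ * (g.len a)⁻¹ * Real.exp (-(δ * g.dist a b)))) :
    HasL2Majorant (g := toB6 g R H) blk (pOne D D' Ds Ds' P Pp)
      (fun a b => kappa377 cE κP κP' Λ (B6.c1 d δ₀ β) α₁ * α₁ * (g.len a ^ 2)⁻¹ * Real.exp (-(ρ * g.dist a b))) := by
  -- constants, weights and rates
  set c : ℝ := B6.c1 d δ₀ β with hc_def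
  have hc0 : 0 ≤ c := B6RandomWalk.c1_nonneg d δ₀ β
  have hw1 : ∀ a : g.Site, 0 ≤ (g.len a)⁻¹ := fun a => inv_nonneg.mpr (hlen a).le
  have hw2 : ∀ a : g.Site, 0 ≤ (g.len a ^ 2)⁻¹ := fun a => inv_nonneg.mpr (sq_nonneg _)
  have hΛ0 : 0 ≤ Λ := zero_le_one.trans hΛ
  have hcEα : 0 ≤ cE * α₁ := mul_nonneg hcE hα₁
  have hκP'α : 0 ≤ κP' * α₁ := mul_nonneg hκP' hα₁
  have hεnn : 0 ≤ (α + β) * δ₀ := by positivity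
  have hαδ : 0 ≤ α * δ₀ := by positivity
  set r : ℝ := ρ + (α + β) * δ₀ with hr_def
  have hρr : ρ + (α + β) * δ₀ ≤ r := le_of_eq hr_def.symm
  have hρr' : ρ ≤ r := by rw [hr_def]; linarith
  have hr0 : 0 ≤ r := hρ.trans hρr'
  have hrδ : r + (α + β) * δ₀ ≤ δ := by rw [hr_def]; linarith
  have hrδ' : r ≤ δ := by linarith
  have hρδ : ρ + (α + β) * δ₀ ≤ δ := hρr.trans hrδ'
  have hρδ' : ρ ≤ δ := hρr'.trans hrδ'
  -- rate-weakened letters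
  have hPDsρ := hasL2Majorant_rate_mono (R := R) (H := H) blk κP (fun a => (g.len a)⁻¹) hκP hw1 hρδ' hdnn hPDs
  have hEsρ := hasL2Majorant_rate_mono (R := R) (H := H) blk (cE * α₁) (fun a => (g.len a)⁻¹) hcEα hw1 hρδ' hdnn hEs
  have hPpDsρ := hasL2Majorant_rate_mono (R := R) (H := H) blk (κP' * α₁) (fun a => (g.len a)⁻¹) hκP'α hw1 hρδ' hdnn
    hPpDs
  have hDPpDsρ := hasL2Majorant_rate_mono (R := R) (H := H) blk (κP' * α₁) (fun a => (g.len a ^ 2)⁻¹) hκP'α hw2 hρδ'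
    hdnn hDPpDs
  -- unweighted forms of `P`, `P′` (right factors of `E·P`, `E·P′` at the intermediate rate `r`)
  have hPr : HasL2Majorant (g := toB6 g R H) blk P (fun a b => κP * Real.exp (-(r * g.dist a b))) :=
    hasL2Majorant_mono (g := toB6 g R H) blk hP fun a b =>
      mul_le_mul_of_nonneg_left (Real.exp_le_exp.mpr (by nlinarith [hdnn a b])) hκP
  have hPpr : HasL2Majorant (g := toB6 g R H) blk Pp (fun a b => κP' * α₁ * Real.exp (-(r * g.dist a b))) :=
    hasL2Majorant_mono (g := toB6 g R H) blk hPp fun a b =>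
      mul_le_mul_of_nonneg_left (Real.exp_le_exp.mpr (by nlinarith [hdnn a b])) hκP'α
  -- word 1: `E·(P·D*)`
  have w1 := hasL2Majorant_comp_decay (R := R) (H := H) blk d δ₀ α β ρ δ Λ (cE * α₁) κP (fun a => (g.len a)⁻¹)
    (fun a => (g.len a)⁻¹) hw1 hw1 hΛ0 hcEα hκP hρ hρδ hdnn htri hT1i h261 hE hPDsρ
  -- word 2: `(D·P)·E*`
  have w2 := hasL2Majorant_comp_decay (R := R) (H := H) blk d δ₀ α β ρ δ Λ κP (cE * α₁) (fun a => (g.len a)⁻¹)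
    (fun a => (g.len a)⁻¹) hw1 hw1 hΛ0 hκP hcEα hρ hρδ hdnn htri hT1i h261 hDP hEsρ
  -- word 3: `(E·P)·E*`
  have w3a := hasL2Majorant_comp_decay_right1 (R := R) (H := H) blk d δ₀ α β r δ (cE * α₁) κP (fun a => (g.len a)⁻¹)
    hw1 hcEα hκP hr0 hαδ hrδ hdnn htri h261 hE hPr
  have w3 := hasL2Majorant_comp_decay (R := R) (H := H) blk d δ₀ α β ρ r Λ (cE * α₁ * κP * c) (cE * α₁)
    (fun a => (g.len a)⁻¹) (fun a => (g.len a)⁻¹) hw1 hw1 hΛ0 (by positivity) hcEα hρ hρr hdnn htri hT1i h261 w3a hEsρ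
  -- word 5: `E·(P′·D*)`
  have w5 := hasL2Majorant_comp_decay (R := R) (H := H) blk d δ₀ α β ρ δ Λ (cE * α₁) (κP' * α₁) (fun a => (g.len a)⁻¹)
    (fun a => (g.len a)⁻¹) hw1 hw1 hΛ0 hcEα hκP'α hρ hρδ hdnn htri hT1i h261 hE hPpDsρ
  -- word 6: `(D·P′)·E*`
  have w6 := hasL2Majorant_comp_decay (R := R) (H := H) blk d δ₀ α β ρ δ Λ (κP' * α₁) (cE * α₁) (fun a => (g.len a)⁻¹)
    (fun a => (g.len a)⁻¹) hw1 hw1 hΛ0 hκP'α hcEα hρ hρδ hdnn htri hT1i h261 hDPp hEsρ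
  -- word 7: `(E·P′)·E*`
  have w7a := hasL2Majorant_comp_decay_right1 (R := R) (H := H) blk d δ₀ α β r δ (cE * α₁) (κP' * α₁)
    (fun a => (g.len a)⁻¹) hw1 hcEα hκP'α hr0 hαδ hrδ hdnn htri h261 hE hPpr
  have w7 := hasL2Majorant_comp_decay (R := R) (H := H) blk d δ₀ α β ρ r Λ (cE * α₁ * (κP' * α₁) * c) (cE * α₁)
    (fun a => (g.len a)⁻¹) (fun a => (g.len a)⁻¹) hw1 hw1 hΛ0 (by positivity) hcEα hρ hρr hdnn htri hT1i h261 w7a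
    hEsρ
  -- assemble
  have hsum := hasL2Majorant_add (g := toB6 g R H) blk
    (hasL2Majorant_add (g := toB6 g R H) blk
      (hasL2Majorant_add (g := toB6 g R H) blk
        (hasL2Majorant_add (g := toB6 g R H) blk
          (hasL2Majorant_add (g := toB6 g R H) blk (hasL2Majorant_add (g := toB6 g R H) blk w1 w2) w3) hDPpDsρ) w5) w6) w7
  rw [hD', hDs', pOne_expand]
  refine hasL2Majorant_mono (g := toB6 g R H) blk hsum fun a b => le_of_eq ?_
  have ha : g.len a ≠ 0 := (hlen a).ne'
  simp only [kappa377]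
  field_simp
  ring


end Ineq377

section Assembly

variable {g : B9.Geometry} [Fintype g.Site] [DecidableEq g.Site] {R : ℝ} {H : Prop} {W : Type} [Fintype W]

/-- **(3.77) with the `P(U)`-entries DISCHARGED** from the Theorem-3.1/3.2-shaped inputs by gen 6's (3.49) operator form
(`B9Ineq368PPrime.ineq349_op`, `P(U) = B9Eq360Vprime.pOp G Qs Cinv Q` of (3.25), `κ_P = κ₃₄₉ = κ_Q²B₀²B₁Λ⁴c²`): (3.42)₁₋₃
for `G′`, `∇G′`, `G′∇*`, (3.48) for `(Q′G′²Q′*)⁻¹`, `Q′`, `Q′*` block-local (`κ_Q`), the scale transfers for `Lʲη`, `(Lʲη)²`,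
`(Lʲη)⁻⁴`, `(Lʲη)⁻¹`; the (3.68)-entries of `P′(A)` and the letters `E`, `E*` as in `ineq377_op`, all at the (3.49)-output
rate `ρ₁` (`ρ₁ + (2α+β)δ₀ ≦ δ`); conclusion at any `ρ ≧ 0` with `ρ + 2(α+β)δ₀ ≦ ρ₁`.
[cite: Balaban1985BackgroundPropagators, (3.77) p.406 + (3.49) p.399 + (3.25) p.394 + Thm 3.1/3.2 pp.397–398; Balaban1984PropagatorsII, Lemma 2.1 p.234] -/
theorem ineq377_l2_of_349 (blk : W → g.Site) (d : ℕ) (δ₀ δ α β ρ₁ ρ Λ κQ B₀ B₁ cE κP' α₁ : ℝ)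
    (hκQ : 0 ≤ κQ) (hB₀ : 0 ≤ B₀) (hB₁ : 0 ≤ B₁) (hcE : 0 ≤ cE) (hκP' : 0 ≤ κP') (hα₁ : 0 ≤ α₁) (hΛ : 1 ≤ Λ)
    (hρ₁ : 0 ≤ ρ₁) (hρ : 0 ≤ ρ) (hα : 0 ≤ α) (hβ : 0 ≤ β) (hδ₀ : 0 ≤ δ₀)
    (hr₁ : ρ₁ + (2 * α + β) * δ₀ ≤ δ) (hr : ρ + 2 * ((α + β) * δ₀) ≤ ρ₁)
    (hdnn : ∀ a b : g.Site, 0 ≤ g.dist a b) (htri : Triangle254 (toB6 g R H)) (hlen : ∀ y : g.Site, 0 < g.len y)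
    (h261 : Ineq261 d (toB6 g R H) δ₀ β)
    (hT1 : ScaleTransfer g δ₀ α Λ (fun a => g.len a)) (hT2 : ScaleTransfer g δ₀ α Λ (fun a => g.len a ^ 2))
    (hT4 : ScaleTransfer g δ₀ α Λ (fun a => (g.len a ^ 4)⁻¹)) (hT1i : ScaleTransfer g δ₀ α Λ (fun a => (g.len a)⁻¹))
    {G D Ds Qs Q Cinv D' Ds' E Es Pp : Module.End ℝ (W → ℝ)} (hD' : D' = D + E) (hDs' : Ds' = Ds + Es)
    (hQ : HasL2Majorant (g := toB6 g R H) blk Q (fun a b : g.Site => if a = b then κQ else 0))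
    (hQs : HasL2Majorant (g := toB6 g R H) blk Qs (fun a b : g.Site => if a = b then κQ else 0))
    (hG : HasL2Majorant (g := toB6 g R H) blk G (fun a b => B₀ * g.len a ^ 2 * Real.exp (-(δ * g.dist a b))))
    (hDG : HasL2Majorant (g := toB6 g R H) blk (D * G) (fun a b => B₀ * g.len a * Real.exp (-(δ * g.dist a b))))
    (hGDs : HasL2Majorant (g := toB6 g R H) blk (G * Ds) (fun a b => B₀ * g.len a * Real.exp (-(δ * g.dist a b))))
    (hCinv : HasL2Majorant (g := toB6 g R H) blk Cinv
      (fun a b => B₁ * (g.len a ^ 4)⁻¹ * Real.exp (-(δ * g.dist a b))))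
    (hPp : HasL2Majorant (g := toB6 g R H) blk Pp (fun a b => κP' * α₁ * Real.exp (-(ρ₁ * g.dist a b))))
    (hDPp : HasL2Majorant (g := toB6 g R H) blk (D * Pp)
      (fun a b => κP' * α₁ * (g.len a)⁻¹ * Real.exp (-(ρ₁ * g.dist a b))))
    (hPpDs : HasL2Majorant (g := toB6 g R H) blk (Pp * Ds)
      (fun a b => κP' * α₁ * (g.len a)⁻¹ * Real.exp (-(ρ₁ * g.dist a b))))
    (hDPpDs : HasL2Majorant (g := toB6 g R H) blk (D * Pp * Ds)
      (fun a b => κP' * α₁ * (g.len a ^ 2)⁻¹ * Real.exp (-(ρ₁ * g.dist a b))))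
    (hE : HasL2Majorant (g := toB6 g R H) blk E (fun a b => cE * α₁ * (g.len a)⁻¹ * Real.exp (-(ρ₁ * g.dist a b))))
    (hEs : HasL2Majorant (g := toB6 g R H) blk Es
      (fun a b => cE * α₁ * (g.len a)⁻¹ * Real.exp (-(ρ₁ * g.dist a b)))) :
    HasL2Majorant (g := toB6 g R H) blk (pOne D D' Ds Ds' (B9Eq360Vprime.pOp G Qs Cinv Q) Pp)
      (fun a b => kappa377 cE (B9Ineq368PPrime.kappa349 κQ B₀ B₁ Λ (B6.c1 d δ₀ β)) κP' Λ (B6.c1 d δ₀ β) α₁ * α₁ *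
        (g.len a ^ 2)⁻¹ * Real.exp (-(ρ * g.dist a b))) := by
  obtain ⟨hP, hDP, hPDs, -⟩ := ineq349_l2 (R := R) (H := H) blk d δ₀ δ α β ρ₁ Λ κQ B₀ B₁ hκQ hB₀
    hB₁ hΛ hρ₁ hα hβ hδ₀ hr₁ hdnn htri hlen h261 hT1 hT2 hT4 hQ hQs hG hDG hGDs hCinv
  have hκ : 0 ≤ B9Ineq368PPrime.kappa349 κQ B₀ B₁ Λ (B6.c1 d δ₀ β) := by
    unfold B9Ineq368PPrime.kappa349
    have := B6RandomWalk.c1_nonneg d δ₀ β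
    have hΛ0 : 0 ≤ Λ := zero_le_one.trans hΛ
    positivity
  exact ineq377_l2 (R := R) (H := H) blk d δ₀ ρ₁ α β ρ Λ cE _ κP' α₁ hcE hκ hκP' hα₁ hΛ hρ hα hβ hδ₀ hr hdnn htri
    hlen h261 hT1i hD' hDs' hP hDP hPDs hPp hDPp hPpDs hDPpDs hE hEs

end Assembly

end Literature.MathematicalPhysics.QuantumFieldTheory.Balaban1983to89.B9Ineq377L2
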